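import Summits.HubbardSuperconductivity.HubbardSuperconductivity.Theorems.NodalDiracTwistTwistCalibrationBdGNambuBlocks
import Literature.MathematicalPhysics.QuantumLattice.BlochBogoliubovImplementer

/-!
# Route `NodalDiracTwist` — support `TwistCalibrationBdG`: the Nambu rotation and the Bogoliubov mode matrix

Third helper file for stmt-HubbardSuperconductivity-1625: the `2 × 2` BdG algebra in complex form.
For a unit spinor `p` with `|z| p² = -z` (`z = a + ib`; `p = nambuLower z` qualifies),
**`Q_k(a, b) = |z| (n(u₊) - n(u₋))`** (`nambuQuad_eq_norm_smul`) with the Nambu modes `u₋ = nambuMode k p`,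
`u₊ = nambuMode k (-ip)`; inner products of Nambu modes; **unitarity of `bdgModeMatrix`**
(`bdgModeMatrix_conjTranspose_mul_self`, `…_mem_unitaryGroup`); and the change of one-particle basis
`Γ(U) n_j Γ(U)ᴴ = n(U e_j)` (`Gamma_conj_numberAt`) with the diagonal action `Σ_j e_j n_j` of a real
combination of occupation numbers (`sum_smul_numberAt_mulVec`).

Sources: de Gennes (1966) Ch. 5, eqs. (5-12)–(5-18); Bratteli–Robinson II §5.2.1. No definitions.
-/

-- the mandated namespace `Summit.<Summit>.<Problem>.Theorems` repeats `HubbardSuperconductivity`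
-- (single-problem summit, D-0017), which the `dupNamespace` linter flags on every declaration
set_option linter.dupNamespace false

namespace Summit.HubbardSuperconductivity.HubbardSuperconductivity.Theorems.NodalDiracTwist

open Matrix Finset Literature.Probability.LatticeModels Literature.MathematicalPhysics.QuantumLattice
open scoped ComplexConjugate

variable {d L : ℕ} [NeZero L]

/-! ### The Nambu rotation: `Q_k(a,b) = E (n(u₊) - n(u₋))` -/

section Nambu

/-- The `ℝ²`-inner product of `p` and `-ip` vanishes: `Re(conj(-ip) p) = 0`. [folklore] -/
theorem re_conj_neg_I_mul_mul (p : ℂ) : ((starRingEnd ℂ) (-Complex.I * p) * p).re = 0 := by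
  simp [Complex.mul_re, Complex.mul_im, Complex.conj_re, Complex.conj_im]; ring

/-- `c(u) = x c_{k↑} + y c_{k↓}` for the Nambu mode `u` with spinor `(x, y)`. [folklore] -/
theorem annihilate_nambuMode (k : TorusSite d L) (p : ℂ) :
    RayleighBound.annihilate (nambuMode L k p) =
      (p.re : ℂ) • momentumAnnihilation k 0 + (p.im : ℂ) • momentumAnnihilation k 1 := by
  rw [RayleighBound.annihilate, momentumAnnihilation_eq_sum_planeWave,
    momentumAnnihilation_eq_sum_planeWave, Finset.smul_sum, Finset.smul_sum, ← Finset.sum_add_distrib]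
  refine Finset.sum_congr rfl fun o _ => ?_
  rw [nambuMode, smul_smul, smul_smul, ← add_smul]
  congr 1
  simp only [star_mul', star_add, star_torusFourierWeight, Complex.star_def, Complex.conj_ofReal]
  ring

/-- `c†(u) = x c†_{k↑} + y c†_{k↓}`. [folklore] -/
theorem create_nambuMode (k : TorusSite d L) (p : ℂ) :
    RayleighBound.create (nambuMode L k p) =
      (p.re : ℂ) • momentumCreation k 0 + (p.im : ℂ) • momentumCreation k 1 := by
  rw [← RayleighBound.annihilate_conjTranspose, annihilate_nambuMode, conjTranspose_add,
    conjTranspose_smul, conjTranspose_smul, momentumAnnihilation_conjTranspose,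
    momentumAnnihilation_conjTranspose]
  simp only [Complex.star_def, Complex.conj_ofReal]

/-- `n(u) = x² n_{k↑} + y² n_{k↓} + xy (c†_{k↓}c_{k↑} + c†_{k↑}c_{k↓})`. [folklore] -/
theorem numberMode_nambuMode (k : TorusSite d L) (p : ℂ) :
    RayleighBound.numberMode (nambuMode L k p) =
      ((p.re : ℂ) * p.re) • momentumNumber k 0 + ((p.im : ℂ) * p.im) • momentumNumber k 1 +
        ((p.re : ℂ) * p.im) • (momentumCreation k 1 * momentumAnnihilation k 0 +
          momentumCreation k 0 * momentumAnnihilation k 1) := by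
  rw [RayleighBound.numberMode, create_nambuMode, annihilate_nambuMode, add_mul, mul_add, mul_add,
    smul_mul_smul_comm, smul_mul_smul_comm, smul_mul_smul_comm, smul_mul_smul_comm, ← momentumNumber,
    ← momentumNumber]
  rw [mul_comm (p.im : ℂ) (p.re : ℂ)]
  module

/-- **The Nambu rotation.** If the unit spinor `p` satisfies `|z| p² = -z` for `z = a + ib`, then
`Q_k(a, b) = |z| (n(u₊) - n(u₋))` with `u₋` the mode of spinor `p` and `u₊` that of `-ip`: the Nambu
block is diagonal in the Bogoliubov modes, with energies `±|z| = ±√(a² + b²)`.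
de Gennes (1966) Ch. 5, eqs. (5-12)–(5-18). [folklore] -/
theorem nambuQuad_eq_norm_smul (k : TorusSite d L) (a b : ℝ) (p : ℂ)
    (hpz : (‖(a : ℂ) + b * Complex.I‖ : ℂ) * p ^ 2 = -((a : ℂ) + b * Complex.I)) :
    nambuQuad L k a b = (‖(a : ℂ) + b * Complex.I‖ : ℂ) •
      (RayleighBound.numberMode (nambuMode L k (-Complex.I * p)) -
        RayleighBound.numberMode (nambuMode L k p)) := by
  set E : ℝ := ‖(a : ℂ) + b * Complex.I‖ with hE
  -- real and imaginary parts of the eigenvector relation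
  have hre : E * (p.re * p.re - p.im * p.im) = -a := by
    have h := congrArg Complex.re hpz
    rw [Complex.re_ofReal_mul, pow_two, Complex.mul_re] at h
    simp at h
    linarith
  have him : E * (2 * p.re * p.im) = -b := by
    have h := congrArg Complex.im hpz
    rw [Complex.im_ofReal_mul, pow_two, Complex.mul_im] at h
    simp at h
    linarith
  have hre' : (E : ℂ) * ((p.re : ℂ) * p.re - (p.im : ℂ) * p.im) = -(a : ℂ) := by exact_mod_cast hre
  have him' : (E : ℂ) * (2 * (p.re : ℂ) * p.im) = -(b : ℂ) := by exact_mod_cast him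
  rw [numberMode_nambuMode, numberMode_nambuMode, nambuQuad]
  simp only [neg_mul, Complex.neg_re, Complex.neg_im, Complex.mul_re, Complex.mul_im, Complex.I_re,
    Complex.I_im, zero_mul, one_mul, zero_sub, zero_add, neg_neg, Complex.ofReal_neg]
  match_scalars
  · linear_combination hre'
  · linear_combination -hre'
  · linear_combination him'
  · linear_combination him'


/-- Inner products of Nambu modes: `⟨u_k(p), u_{k'}(p')⟩ = δ_{kk'} Re(conj p · p')` (the spinors are
real, the plane waves orthonormal). [folklore] -/
theorem star_nambuMode_dotProduct (k k' : TorusSite d L) (p p' : ℂ) :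
    star (nambuMode L k p) ⬝ᵥ nambuMode L k' p' =
      if k = k' then ((((starRingEnd ℂ) p * p').re : ℝ) : ℂ) else 0 := by
  have hS := sum_conj_planeWave_mul_planeWave (L := L) k k'
  simp only [dotProduct, Pi.star_apply, nambuMode]
  have hterm : ∀ o : Orb (FermionTorus d L),
      star (torusFourierWeight d L * ((p.re : ℂ) * planeWave k 0 o + (p.im : ℂ) * planeWave k 1 o)) *
        (torusFourierWeight d L * ((p'.re : ℂ) * planeWave k' 0 o + (p'.im : ℂ) * planeWave k' 1 o)) =
      (p.re : ℂ) * p'.re * (star (torusFourierWeight d L * planeWave k 0 o) *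
          (torusFourierWeight d L * planeWave k' 0 o)) +
      (p.re : ℂ) * p'.im * (star (torusFourierWeight d L * planeWave k 0 o) *
          (torusFourierWeight d L * planeWave k' 1 o)) +
      (p.im : ℂ) * p'.re * (star (torusFourierWeight d L * planeWave k 1 o) *
          (torusFourierWeight d L * planeWave k' 0 o)) +
      (p.im : ℂ) * p'.im * (star (torusFourierWeight d L * planeWave k 1 o) *
          (torusFourierWeight d L * planeWave k' 1 o)) := by
    intro o
    simp only [star_mul', star_add, Complex.star_def, Complex.conj_ofReal]
    ring
  simp only [hterm, Finset.sum_add_distrib, ← Finset.mul_sum, hS]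
  by_cases hk : k = k'
  · subst hk
    simp only [true_and, if_true, Fin.zero_eq_one_iff, OfNat.ofNat_ne_one, if_false, Fin.one_eq_zero_iff,
      mul_one, mul_zero, add_zero]
    simp only [Complex.mul_re, Complex.conj_re, Complex.conj_im]
    push_cast
    ring
  · simp [hk]

omit [NeZero L] in
/-- The Bogoliubov spinors at fixed `k` are `ℝ²`-orthonormal. [folklore] -/
theorem re_conj_bdgSpinor_mul (μ₀ h : ℝ) (φ : Fin d → ℝ) (k : TorusSite d L) (σ τ : Fin 2) :
    ((starRingEnd ℂ) (bdgSpinor L μ₀ h φ k σ) * bdgSpinor L μ₀ h φ k τ).re =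
      if σ = τ then 1 else 0 := by
  have hn := norm_nambuLower (twistNambuZ L μ₀ h φ k)
  have hsq : ((starRingEnd ℂ) (nambuLower (twistNambuZ L μ₀ h φ k)) *
      nambuLower (twistNambuZ L μ₀ h φ k)).re = 1 := by
    rw [Complex.conj_mul', ← Complex.ofReal_pow, Complex.ofReal_re, hn, one_pow]
  have h0 := re_conj_neg_I_mul_mul (nambuLower (twistNambuZ L μ₀ h φ k))
  fin_cases σ <;> fin_cases τ
  · simp only [bdgSpinor, Fin.zero_eta, if_true]
    rw [map_mul, map_neg, Complex.conj_I, neg_neg, show ∀ a b : ℂ, Complex.I * a * (-Complex.I * b) =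
      a * b from fun a b => by ring_nf; rw [Complex.I_sq]; ring, hsq]
  · simp only [bdgSpinor, Fin.zero_eta, if_true, Fin.mk_one, one_ne_zero, if_false]
    rw [h0]; simp
  · simp only [bdgSpinor, Fin.zero_eta, if_true, Fin.mk_one, one_ne_zero, if_false]
    rw [← Complex.conj_conj (-Complex.I * _), ← map_mul, Complex.conj_re, mul_comm, h0]
  · simp only [bdgSpinor, Fin.mk_one, one_ne_zero, if_false]
    rw [hsq]; simp

/-- **The mode matrix is unitary.** [folklore] -/
theorem bdgModeMatrix_conjTranspose_mul_self (μ₀ h : ℝ) (φ : Fin d → ℝ) :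
    (bdgModeMatrix L μ₀ h φ)ᴴ * bdgModeMatrix L μ₀ h φ = 1 := by
  ext o₁ o₂
  obtain ⟨⟨x₁, σ₁⟩, rfl⟩ : ∃ q : FermionTorus d L × Fin 2, toLex q = o₁ := ⟨ofLex o₁, toLex_ofLex o₁⟩
  obtain ⟨⟨x₂, σ₂⟩, rfl⟩ : ∃ q : FermionTorus d L × Fin 2, toLex q = o₂ := ⟨ofLex o₂, toLex_ofLex o₂⟩
  change ((bdgModeMatrix L μ₀ h φ)ᴴ * bdgModeMatrix L μ₀ h φ) (orb x₁ σ₁) (orb x₂ σ₂) =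
    (1 : Matrix _ _ ℂ) (orb x₁ σ₁) (orb x₂ σ₂)
  rw [Matrix.mul_apply]
  have : ∑ o, (bdgModeMatrix L μ₀ h φ)ᴴ (orb x₁ σ₁) o * bdgModeMatrix L μ₀ h φ o (orb x₂ σ₂) =
      star (nambuMode L x₁.toTorusSite (bdgSpinor L μ₀ h φ x₁.toTorusSite σ₁)) ⬝ᵥ
        nambuMode L x₂.toTorusSite (bdgSpinor L μ₀ h φ x₂.toTorusSite σ₂) := by
    rw [← bdgModeMatrix_col, ← bdgModeMatrix_col]
    rfl
  rw [this, star_nambuMode_dotProduct, Matrix.one_apply]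
  simp only [orb_eq_orb_iff]
  have hinj : x₁.toTorusSite = x₂.toTorusSite ↔ x₁ = x₂ :=
    (FermionTorus.equivTorusSite (d := d) (L := L)).injective.eq_iff
  by_cases hx : x₁ = x₂
  · subst hx
    rw [if_pos rfl, re_conj_bdgSpinor_mul]
    by_cases hs : σ₁ = σ₂ <;> simp [hs]
  · rw [if_neg (fun h' => hx (hinj.mp h')), if_neg (fun h' => hx h'.1)]

/-- The mode matrix is unitary (as a member of the unitary group). [folklore] -/
theorem bdgModeMatrix_mem_unitaryGroup (μ₀ h : ℝ) (φ : Fin d → ℝ) :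
    bdgModeMatrix L μ₀ h φ ∈ Matrix.unitaryGroup (Orb (FermionTorus d L)) ℂ := by
  rw [Matrix.mem_unitaryGroup_iff', star_eq_conjTranspose]
  exact bdgModeMatrix_conjTranspose_mul_self μ₀ h φ

/-- `U Uᴴ = 1` as well. [folklore] -/
theorem bdgModeMatrix_mul_conjTranspose_self (μ₀ h : ℝ) (φ : Fin d → ℝ) :
    bdgModeMatrix L μ₀ h φ * (bdgModeMatrix L μ₀ h φ)ᴴ = 1 := by
  have hU := bdgModeMatrix_mem_unitaryGroup (L := L) μ₀ h φ
  rw [Matrix.mem_unitaryGroup_iff, star_eq_conjTranspose] at hU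
  exact hU

end Nambu

/-! ### Conjugating number operators by `Γ(U)` -/

section GammaConj

-- the local `DecidableEq` binder makes these lemmas rewrite terms elaborated at concrete orbital
-- types, where instance resolution finds a structural instance rather than `LinearOrder.toDecidableEq`
variable {ι : Type*} [LinearOrder ι] [Fintype ι] [DecidableEq ι]

/-- `Γ(U) c†_j Γ(U)ᴴ = c†(U e_j)` for `U Uᴴ = 1`. Bratteli–Robinson II §5.2.1. [folklore] -/
theorem Gamma_conj_creation {U : Matrix ι ι ℂ} (hU : U * Uᴴ = 1) (j : ι) :
    Gamma U * creation j * (Gamma U)ᴴ = RayleighBound.create (fun i => U i j) := by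
  have h1 : Gamma (1 : Matrix ι ι ℂ) = 1 := by convert Gamma_one (ι := ι)
  rw [Gamma_mul_creation, Matrix.mul_assoc, ← Gamma_conjTranspose, ← Gamma_mul, hU, h1,
    Matrix.mul_one]

/-- `Γ(U) c_j Γ(U)ᴴ = c(U e_j)` for `U Uᴴ = 1`. Bratteli–Robinson II §5.2.1. [folklore] -/
theorem Gamma_conj_annihilation {U : Matrix ι ι ℂ} (hU : U * Uᴴ = 1) (j : ι) :
    Gamma U * annihilation j * (Gamma U)ᴴ = RayleighBound.annihilate (fun i => U i j) := by
  have h := congrArg conjTranspose (Gamma_conj_creation hU j)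
  rw [conjTranspose_mul, conjTranspose_mul, conjTranspose_conjTranspose, creation_conjTranspose,
    ← Matrix.mul_assoc, RayleighBound.create_conjTranspose] at h
  exact h

/-- **`Γ(U) n_j Γ(U)ᴴ = n(U e_j)`**: a unitary change of one-particle basis maps occupation numbers
to the occupation numbers of the rotated modes. Bratteli–Robinson II §5.2.1. [folklore] -/
theorem Gamma_conj_numberAt {U : Matrix ι ι ℂ} (hU : U * Uᴴ = 1) (hU' : Uᴴ * U = 1) (j : ι) :
    Gamma U * numberAt j * (Gamma U)ᴴ = RayleighBound.numberMode (fun i => U i j) := by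
  have h1 : (Gamma U)ᴴ * Gamma U = 1 := by
    rw [← Gamma_conjTranspose, ← Gamma_mul, hU']
    convert Gamma_one (ι := ι)
  calc Gamma U * numberAt j * (Gamma U)ᴴ
      = (Gamma U * creation j * (Gamma U)ᴴ) * (Gamma U * annihilation j * (Gamma U)ᴴ) := by
        rw [numberAt]
        simp only [Matrix.mul_assoc]
        rw [← Matrix.mul_assoc (Gamma U)ᴴ (Gamma U), h1, Matrix.one_mul]
    _ = _ := by rw [Gamma_conj_creation hU, Gamma_conj_annihilation hU, RayleighBound.numberMode]

/-- A real-weighted sum of occupation numbers acts diagonally in the occupation basis: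
`(Σ_j e_j n_j) χ (s) = (Σ_{j ∈ s} e_j) χ(s)`. [folklore] -/
theorem sum_smul_numberAt_mulVec (e : ι → ℝ) (χ : Fock ι) :
    (∑ j, ((e j : ℝ) : ℂ) • numberAt j) *ᵥ χ = fun s => (((∑ j ∈ s, e j : ℝ)) : ℂ) * χ s := by
  funext s
  rw [Matrix.sum_mulVec, Finset.sum_apply]
  simp only [Matrix.smul_mulVec, Pi.smul_apply, numberAt_eq_diagonal, mulVec_diagonal, smul_eq_mul,
    ite_mul, one_mul, zero_mul, mul_ite, mul_zero]
  rw [Complex.ofReal_sum, Finset.sum_mul, Finset.sum_ite_mem, Finset.univ_inter]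

end GammaConj

end Summit.HubbardSuperconductivity.HubbardSuperconductivity.Theorems.NodalDiracTwist
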